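import Summits.HodgeConjecture.HodgeConjecture.Theses.HolomorphicityRate
import Literature.AlgebraicGeometry.HodgeTheory.ComplexGysinHodgeType
import Literature.AlgebraicGeometry.HodgeTheory.HodgeFiltrationModelsReductionProofs
import Literature.AlgebraicGeometry.HodgeTheory.ComplexConjugationHolds
import Literature.AlgebraicGeometry.HodgeTheory.SupportedClassesHodgeConiveau
import Literature.AlgebraicGeometry.HodgeTheory.MiddleDimensionReductionOfHodgeModels
import Literature.NumberTheory.Transcendental.DeRhamTheoremMultiplicative
import Literature.Geometry.Kaehler.NearlyHolomorphicCycleSupport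
import Summits.HodgeConjecture.HodgeConjecture.Theorems.HolomorphicityRateDefs

/-!
# Route HolomorphicityRate — `ThresholdForcesHodgeType` (item stmt-HodgeConjecture-10764) from a
# tilt inequality for nearly holomorphic cycle supports

The support item `ThresholdForcesHodgeType` (E2 of the card *holomorphicity-rate-threshold*): for
`X` smooth projective of dimension `n`, `p ≤ n`, a Hodge model `A`, a smooth metric `g`, classes
`c, hp ∈ H²ᵖ(X(ℂ); ℂ)` (`hp` rational algebraic), `m ≥ 1`, `a_k ≤ C kᵖ` and defects `t_k` with
`t_k kᵖ → 0`: if for infinitely many `k` the ray class `γ_k = m•c + a_k•hp` is supported on a nearly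
holomorphic cycle support of defect `≤ t_k`, then `A^* c ∈ H^{p,p}(A)`.

The printed mechanism of the item has two halves:

* (GMT) the **tilt inequality**: a class `γ` supported on a nearly holomorphic cycle support `S` of
  small defect `t` is `λ [S]`, and pairs with a class `b` of pure OFF type `(p', q')`
  (`(p', q') ≠ (n - p, n - p)`) at most like `|t|` times its pairing with a fixed calibrating class
  `η` (`ω^{n-p}`): off-type forms are `O(t)` on `t`-nearly complex planes and `ω^{n-p}/(n-p)!`
  restricts to `(1 - O(t²))` times the volume (Wirtinger), `|⟨γ ∪ b, [X]⟩| ≤ K |t| |⟨γ ∪ η, [X]⟩|`;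
* (Hodge) **Voisin I, Lemma 7.30**: a class pairing to zero with every pure off-type class is of
  type `(p, p)` — PROVED in the tree (`HodgeModel.mem_hodgePQ_of_forall_cupPairing_eq_zero`), its
  inputs `hodgePQ_independent_of_hodgeModel`, `nonempty_hodgeModel`, `exists_deRhamIsoFamily` being
  discharged (`…_holds`), together with the elimination of the algebraic summand `a_k•hp`
  (algebraic classes are of type `(p, p)`: Grothendieck 1969 (∗) with the sub-Hodge remark, the
  tree's named fact `Grothendieck1969_supportedClasses_le_hodgeConiveau`) and the limit along the
  ray (`‖m ⟨c ∪ b⟩‖ ≤ K |t_k| (m ‖⟨c ∪ η⟩‖ + a_k ‖⟨hp ∪ η⟩‖) = O(|t_k| kᵖ) → 0`).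

This file PROVES the second half: `thresholdForcesHodgeType_of_tilt` derives the route decl
`ThresholdForcesHodgeType` verbatim from

1. an orientation family `μ` (the pairings `⟨· ∪ ·, [X(ℂ)]_μ⟩`; any family works),
2. the named fact `Grothendieck1969_supportedClasses_le_hodgeConiveau` (only through "algebraic
   classes of codimension `p` are of type `(p, p)` in every Hodge model",
   `pullback_mem_hodgePQ_of_mem_algebraicClasses`),
3. the tilt inequality, as an explicit hypothesis in the middle range `0 < p < n` (shape
   `htilt` below; NOT a named fact of the literature — it is the geometric-measure-theoretic core
   of the item, isolated here as the one remaining analytic statement, phrased on the tree's carriers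
   `IsNearlyHolomorphicCycleSupport`, `cupPairing`, `HodgeModel.hodgePQ` without any integration).

The extreme codimensions `p = 0`, `p = n` need nothing (every class of `H⁰`, resp. `H²ⁿ`, is of
type `(0,0)`, resp. `(n,n)`).
-/

-- `Summit.HodgeConjecture.HodgeConjecture.Theorems` is the mandated namespace (single-problem summit:
-- Problem = Summit), which `linter.dupNamespace` flags on every declaration; the lakefile turns the
-- linter off tree-wide (weak option), restated here so stand-alone elaboration is warning-free too.
set_option linter.dupNamespace false

noncomputable section

namespace Summit.HodgeConjecture.HodgeConjecture.Theorems

open scoped Manifold ContDiff Topology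
open Filter Set
open Literature.AlgebraicGeometry.HodgeTheory Literature.AlgebraicGeometry.Motives
  Literature.AlgebraicTopology.SingularHomology Literature.NumberTheory.Transcendental
  Literature.Geometry.Kaehler

/-! ### Algebraic classes are of type `(p, p)` (from Grothendieck 1969) -/

/-- **Algebraic classes of codimension `p` are of type `(p, p)` in every Hodge model**, from the
named fact `Grothendieck1969_supportedClasses_le_hodgeConiveau`: `Nᵖ H²ᵖ` pulled back lies in the
classes of Hodge coniveau `≥ p` of degree `2p`, `⨆_{p'+q'=2p, p',q' ≥ p} H^{p',q'} = H^{p,p}`.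
[cite: GrothendieckTopology1969, p. 299 (∗) and p. 300] [cite: VoisinHodgeI2002, §7.1.1 and §11.3] -/
theorem pullback_mem_hodgePQ_of_mem_algebraicClasses
    (hG : Grothendieck1969_supportedClasses_le_hodgeConiveau) {n : ℕ} {X : SchemeOver ℂ}
    (hX : IsSmoothProjective n X) (A : HodgeModel n X) {p : ℕ} {b : complexBetti X (2 * p)}
    (hb : b ∈ algebraicClasses X p) : A.pullback (2 * p) b ∈ A.hodgePQ (2 * p) p p := by
  have h1 : A.pullback (2 * p) b ∈ A.hodgeConiveau (2 * p) p :=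
    Grothendieck1969_supportedClasses_le_hodgeConiveau.pullback_mem_hodgeConiveau hG hX A hb
  refine (?_ : A.hodgeConiveau (2 * p) p ≤ A.hodgePQ (2 * p) p p) h1
  refine iSup_le fun p₁ ↦ iSup_le fun q₁ ↦ iSup_le fun hpq ↦ iSup_le fun hp₁ ↦ iSup_le fun hq₁ ↦ ?_
  obtain rfl : p₁ = p := by omega
  obtain rfl : q₁ = p₁ := by omega
  exact le_rfl

/-! ### Two limit lemmas along the ray -/

/-- If `t_k kᵖ → 0` then `t_k → 0` (for `k ≥ 1`, `|t_k| ≤ |t_k kᵖ|`). [folklore] -/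
theorem tendsto_zero_of_tendsto_mul_pow {t : ℕ → ℝ} {p : ℕ}
    (ht : Tendsto (fun k : ℕ => t k * (k : ℝ) ^ p) atTop (nhds 0)) :
    Tendsto t atTop (nhds 0) := by
  refine squeeze_zero_norm' (eventually_atTop.2 ⟨1, fun k hk ↦ ?_⟩)
    (tendsto_zero_iff_norm_tendsto_zero.1 ht)
  rw [Real.norm_eq_abs, Real.norm_eq_abs, abs_mul]
  have hk1 : (1 : ℝ) ≤ |(k : ℝ) ^ p| := by
    rw [abs_of_nonneg (by positivity)]
    exact one_le_pow₀ (by exact_mod_cast hk)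
  calc |t k| = |t k| * 1 := (mul_one _).symm
    _ ≤ |t k| * |(k : ℝ) ^ p| := mul_le_mul_of_nonneg_left hk1 (abs_nonneg _)

/-- If `t_k kᵖ → 0` and `0 ≤ a_k ≤ C kᵖ` then `|t_k| a_k → 0`. [folklore] -/
theorem tendsto_abs_mul_of_le_pow {t : ℕ → ℝ} {p : ℕ} {a : ℕ → ℕ} {C : ℝ}
    (ha : ∀ k, (a k : ℝ) ≤ C * (k : ℝ) ^ p)
    (ht : Tendsto (fun k : ℕ => t k * (k : ℝ) ^ p) atTop (nhds 0)) :
    Tendsto (fun k : ℕ => |t k| * (a k : ℝ)) atTop (nhds 0) := by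
  have h0 : Tendsto (fun k : ℕ => |C| * ‖t k * (k : ℝ) ^ p‖) atTop (nhds 0) := by
    simpa using (tendsto_zero_iff_norm_tendsto_zero.1 ht).const_mul |C|
  refine squeeze_zero (fun k ↦ mul_nonneg (abs_nonneg _) (Nat.cast_nonneg _)) (fun k ↦ ?_) h0
  rw [Real.norm_eq_abs, abs_mul]
  have hk : (0 : ℝ) ≤ (k : ℝ) ^ p := by positivity
  have h1 : (a k : ℝ) ≤ |C| * |(k : ℝ) ^ p| := by
    rw [abs_of_nonneg hk]
    exact (ha k).trans (mul_le_mul_of_nonneg_right (le_abs_self C) hk)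
  calc |t k| * (a k : ℝ) ≤ |t k| * (|C| * |(k : ℝ) ^ p|) :=
        mul_le_mul_of_nonneg_left h1 (abs_nonneg _)
    _ = |C| * (|t k| * |(k : ℝ) ^ p|) := by ring

/-! ### The reduction -/

/-- **`ThresholdForcesHodgeType` from the tilt inequality.** Hypotheses: an orientation family `μ`;
the named fact `Grothendieck1969_supportedClasses_le_hodgeConiveau` (algebraic classes are of type
`(p, p)`); and the TILT INEQUALITY `htilt` in the middle range `0 < p < n`: for every class `b` of
pure type `(p', q')` not complementary to `(p, p)` there are a class `η` and constants `K`, `t₀ > 0`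
such that every class `γ ∈ H²ᵖ(X(ℂ); ℂ)` supported on a nearly holomorphic cycle support of defect
`|t| ≤ t₀` (for the metric `g`) satisfies `‖⟨γ ∪ b, [X]⟩‖ ≤ K |t| ‖⟨γ ∪ η, [X]⟩‖`. Proof: for
`p = 0` or `p = n` every class is of type `(p, p)`; otherwise, by Voisin I Lemma 7.30
(`HodgeModel.mem_hodgePQ_of_forall_cupPairing_eq_zero`, unconditional through
`hodgePQ_independent_of_hodgeModel_holds`, `nonempty_hodgeModel_holds`, `exists_deRhamIsoFamily_holds`)
it suffices that `⟨c ∪ b, [X]⟩ = 0` for such `b`; `hp` is of type `(p, p)` so `⟨hp ∪ b, [X]⟩ = 0`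
(`cupProduct_eq_zero_of_hodgeType`) and `⟨γ_k ∪ b⟩ = m ⟨c ∪ b⟩`, while
`‖⟨γ_k ∪ η⟩‖ ≤ m ‖⟨c ∪ η⟩‖ + a_k ‖⟨hp ∪ η⟩‖`; along the infinitely many good `k`,
`m ‖⟨c ∪ b⟩‖ ≤ |K| |t_k| (m ‖⟨c ∪ η⟩‖ + a_k ‖⟨hp ∪ η⟩‖) → 0` because `t_k → 0` and
`|t_k| a_k ≤ |C| |t_k kᵖ| → 0`. [cite: VoisinHodgeI2002, Lemma 7.30 and §11.3]
[cite: HarveyLawson1982, §II.1 (Wirtinger's inequality)] -/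
theorem thresholdForcesHodgeType_of_tilt (μ : OrientationFamily)
    (hG : Grothendieck1969_supportedClasses_le_hodgeConiveau)
    (htilt : ∀ ⦃n p : ℕ⦄ ⦃X : SchemeOver ℂ⦄ (hX : IsSmoothProjective n X), 0 < p → p < n →
      ∀ (A : HodgeModel n X)
        (g : Bundle.ContMDiffRiemannianMetric 𝓘(ℝ, A.model) ((⊤ : ℕ∞) : WithTop ℕ∞) A.model
          (fun x : A.carrier => TangentSpace 𝓘(ℝ, A.model) x))
        (d : ℕ) (hd : 2 * p + d = 2 * n) (p' q' : ℕ) (b : complexBetti X d),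
        ¬ (p + p' = n ∧ p + q' = n) → A.pullback d b ∈ A.hodgePQ d p' q' →
        ∃ (η : complexBetti X d) (K t₀ : ℝ), 0 < t₀ ∧
          ∀ (t : ℝ) (S Sg : Set A.carrier) (γ : complexBetti X (2 * p)), |t| ≤ t₀ →
            IsNearlyHolomorphicCycleSupport g.toRiemannianMetric p t S Sg →
            singularCohomology.map ℂ ℂ
              (⟨Subtype.val, continuous_subtype_val⟩ : C({x : A.carrier // x ∉ S}, A.carrier))
              (2 * p) (A.pullback (2 * p) γ) = 0 →
            ‖cupPairing (μ hX) hd γ b‖ ≤ K * |t| * ‖cupPairing (μ hX) hd γ η‖) :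
    Summit.HodgeConjecture.HodgeConjecture.Theses.HolomorphicityRate.ThresholdForcesHodgeType := by
  intro n p X hX hpn A g c hp m C a t _hrat halg hm ha ht hfreq
  -- the extreme codimensions: every class is of type `(p, p)`
  rcases Nat.eq_zero_or_pos p with rfl | hp0
  · have h0 : A.hodgePQ (2 * 0) 0 0 = ⊤ := by
      change (hodgePQ A.model A.carrier (2 * 0) 0 0).map (A.deRham A.carrier (2 * 0)).toLinearMap = ⊤
      have : hodgePQ A.model A.carrier (2 * 0) 0 0 = ⊤ := by
        refine eq_top_iff.mpr fun u _ ↦ ?_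
        obtain ⟨β, rfl⟩ := complexDeRhamCohomology.mk_surjective (E := A.model) (M := A.carrier)
          (k := 2 * 0) u
        refine Submodule.subset_span ⟨β, ⟨rfl, fun x θ v ↦ ?_⟩, rfl⟩
        have hv : (fun i ↦ tangentRotate A.model x θ (v i)) = v := funext fun i ↦ Fin.elim0 i
        rw [hv]; simp
      rw [this, Submodule.map_top, LinearEquiv.range]
    rw [h0]; exact Submodule.mem_top
  rcases hpn.eq_or_lt with rfl | hpn'
  · have h0 : A.hodgePQ (2 * p) p p = ⊤ := by
      change (hodgePQ A.model A.carrier (2 * p) p p).map (A.deRham A.carrier (2 * p)).toLinearMap = ⊤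
      rw [hodgePQ_two_mul_finrank_eq_top (M := A.carrier) A.isAnalytification.finrank_eq,
        Submodule.map_top, LinearEquiv.range]
    rw [h0]; exact Submodule.mem_top
  -- the middle range `0 < p < n`: Voisin I, Lemma 7.30
  have hI : hodgePQ_independent_of_hodgeModel := hodgePQ_independent_of_hodgeModel_holds
  have hcup : CupPreservesHodgeType n X :=
    cupPreservesHodgeType_of_nonempty_hodgeModel hI nonempty_hodgeModel_holds
      (fun E _ _ _ ↦ exists_deRhamIsoFamily_holds (E := E)) hX
  have hd : 2 * p + (2 * n - 2 * p) = 2 * n := by omega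
  refine A.mem_hodgePQ_of_forall_cupPairing_eq_zero hI μ hX hcup hd fun p' q' b hne hb ↦ ?_
  -- `hp` is of type `(p, p)`, hence pairs to zero with the off-type class `b`
  have hhp : A.pullback (2 * p) hp ∈ A.hodgePQ (2 * p) p p :=
    pullback_mem_hodgePQ_of_mem_algebraicClasses hG hX A halg
  have hhpb : cupPairing (μ hX) hd hp b = 0 := by
    rw [cupPairing_apply, cupProduct_eq_zero_of_hodgeType hI hX A hcup hd hne hhp hb, map_zero,
      LinearMap.zero_apply]
  -- the tilt inequality for `b`
  obtain ⟨η, K, t₀, ht₀, hK⟩ := htilt hX hp0 hpn' A g (2 * n - 2 * p) hd p' q' b hne hb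
  set x : ℂ := cupPairing (μ hX) hd c b with hx
  set N : ℕ → ℝ := fun k ↦ (m : ℝ) * ‖cupPairing (μ hX) hd c η‖ +
    (a k : ℝ) * ‖cupPairing (μ hX) hd hp η‖ with hN
  -- along every good `k` with `|t k| ≤ t₀`: `m ‖x‖ ≤ |K| |t k| N k`
  have hgood : ∀ k, |t k| ≤ t₀ → (∃ S Sg : Set A.carrier,
      IsNearlyHolomorphicCycleSupport g.toRiemannianMetric p (t k) S Sg ∧
      singularCohomology.map ℂ ℂ
        (⟨Subtype.val, continuous_subtype_val⟩ : C({x : A.carrier // x ∉ S}, A.carrier))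
        (2 * p) (A.pullback (2 * p) (((m : ℂ) • c + ((a k : ℕ) : ℂ) • hp))) = 0) →
      (m : ℝ) * ‖x‖ ≤ |K| * |t k| * N k := by
    intro k htk ⟨S, Sg, hS, hsupp⟩
    have h1 := hK (t k) S Sg ((m : ℂ) • c + ((a k : ℕ) : ℂ) • hp) htk hS hsupp
    have hγb : cupPairing (μ hX) hd ((m : ℂ) • c + ((a k : ℕ) : ℂ) • hp) b = (m : ℂ) * x := by
      rw [map_add, map_smul, map_smul, LinearMap.add_apply, LinearMap.smul_apply,
        LinearMap.smul_apply, hhpb, smul_zero, add_zero, smul_eq_mul]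
    have hγη : ‖cupPairing (μ hX) hd ((m : ℂ) • c + ((a k : ℕ) : ℂ) • hp) η‖ ≤ N k := by
      rw [map_add, map_smul, map_smul, LinearMap.add_apply, LinearMap.smul_apply,
        LinearMap.smul_apply]
      refine (norm_add_le _ _).trans (le_of_eq ?_)
      rw [norm_smul, norm_smul, Complex.norm_natCast, Complex.norm_natCast]
    rw [hγb, norm_mul, Complex.norm_natCast] at h1
    calc (m : ℝ) * ‖x‖ ≤ K * |t k| * ‖cupPairing (μ hX) hd ((m : ℂ) • c + ((a k : ℕ) : ℂ) • hp) η‖ := h1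
      _ ≤ |K| * |t k| * ‖cupPairing (μ hX) hd ((m : ℂ) • c + ((a k : ℕ) : ℂ) • hp) η‖ :=
          mul_le_mul_of_nonneg_right (mul_le_mul_of_nonneg_right (le_abs_self K) (abs_nonneg _))
            (norm_nonneg _)
      _ ≤ |K| * |t k| * N k :=
          mul_le_mul_of_nonneg_left hγη (mul_nonneg (abs_nonneg _) (abs_nonneg _))
  -- the right-hand side tends to `0`
  have hlim : Tendsto (fun k ↦ |K| * |t k| * N k) atTop (nhds 0) := by
    have h1 : Tendsto (fun k ↦ |t k|) atTop (nhds 0) := by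
      simpa using (tendsto_zero_of_tendsto_mul_pow ht).abs
    have h2 : Tendsto (fun k : ℕ => |t k| * (a k : ℝ)) atTop (nhds 0) :=
      tendsto_abs_mul_of_le_pow ha ht
    have h3 : Tendsto (fun k ↦ |K| * ((m : ℝ) * ‖cupPairing (μ hX) hd c η‖ * |t k| +
        ‖cupPairing (μ hX) hd hp η‖ * (|t k| * (a k : ℝ)))) atTop (nhds 0) := by
      simpa using ((h1.const_mul _).add (h2.const_mul _)).const_mul |K|
    refine h3.congr fun k ↦ ?_
    simp only [hN]
    ring
  -- conclude `x = 0`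
  have hmx : (m : ℝ) * ‖x‖ ≤ 0 := by
    refine le_of_forall_pos_lt_add fun δ hδ ↦ ?_
    have hev : ∀ᶠ k in atTop, |K| * |t k| * N k < δ ∧ |t k| ≤ t₀ := by
      refine (hlim.eventually (gt_mem_nhds hδ)).and ?_
      have h1 : Tendsto (fun k ↦ |t k|) atTop (nhds 0) := by
        simpa using (tendsto_zero_of_tendsto_mul_pow ht).abs
      exact h1.eventually (ge_mem_nhds ht₀)
    obtain ⟨k, hk, hkδ, hkt⟩ := (hfreq.and_eventually hev).exists
    have := hgood k hkt (by
      obtain ⟨S, Sg, hS, hsupp⟩ := hk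
      exact ⟨S, Sg, (isNearlyHolomorphicCycleSupport_toRiemannianMetric_iff g).2 hS, hsupp⟩)
    linarith
  have hm0 : (0 : ℝ) < m := by exact_mod_cast hm
  have hx0 : ‖x‖ ≤ 0 := by
    by_contra hxx
    exact absurd hmx (not_le.2 (mul_pos hm0 (not_le.1 hxx)))
  exact norm_le_zero_iff.1 hx0


/-! ### The reduction, with the named hypothesis `TiltInequality` -/

/-- **`ThresholdForcesHodgeType` from the tilt inequality, named form**: the route decl follows
from an orientation family `μ`, the named fact
`Grothendieck1969_supportedClasses_le_hodgeConiveau` (algebraic classes are of type `(p, p)`) and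
the route-posited `HolomorphicityRate.TiltInequality μ` (`Theorems/HolomorphicityRateDefs`), whose
body is verbatim the hypothesis `htilt` of `thresholdForcesHodgeType_of_tilt`. This is the exact
shape of the item's remaining debt: `ThresholdForcesHodgeType` is closed modulo
`TiltInequality μ` (for any one `μ`) and the Grothendieck fact. [cite: VoisinHodgeI2002, Lemma 7.30 and §11.3]
[cite: HarveyLawson1982, §II.1 (Wirtinger's inequality)] -/
theorem thresholdForcesHodgeType_of_tiltInequality (μ : OrientationFamily)
    (hG : Grothendieck1969_supportedClasses_le_hodgeConiveau)
    (htilt : HolomorphicityRate.TiltInequality μ) :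
    Summit.HodgeConjecture.HodgeConjecture.Theses.HolomorphicityRate.ThresholdForcesHodgeType :=
  thresholdForcesHodgeType_of_tilt μ hG htilt

end Summit.HodgeConjecture.HodgeConjecture.Theorems

end
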